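import Mathlib
import Summits.Ventures.HodgeRepro.LitRankChar

/-!
# LitRankKubotaT2 — Kubota's Theorem 2 (the Fermat-type CM-type of `y² = 1 − x^p` is nondegenerate)
follows from Lemma 3 (Leopoldt) and the character formula

Blind cell `pub-hodge-repro`, seat lit-2 (gen 5).  Companion of `LitRank.lean` / `LitRankChar.lean`
(same seat).  Kubota 1965 (store `paper:doi-10-1090-s0002-9947-1965-0190144-8`) p.121 proves
Theorem 2 (p0009:L62–L63: "Let p be an odd prime number.  Then, the Jacobian variety of a complete,
nonsingular model of the curve y² = 1 − x^p is nondegenerate") exactly this way (p0009:L55–L60):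
"Let ζ be a primitive pth root of unity, and let σ_1, …, σ_m be automorphisms of F = Q(ζ) determined
by ζ ↦ ζ^i (i = 1, …, m).  Then, the abelian variety J belongs to the primitive CM-type (F;{σ_i}),
(see [5]), and it follows immediately from Lemma 2 and Lemma 3 that (F;{σ_i}) is nondegenerate."
Lemma 2 (p.119) is the character count, Lemma 3 (H. W. Leopoldt, p0008:L36–L40) the non-vanishing
of the half-sums `Σ_{a=1}^{m} ψ(a)` for odd `ψ`; Kubota's printed proof of Lemma 3
(p0008:L41–p0009:L54) rests on "Θ = Σ_{a=1}^{2m} ψ(a) a ≠ 0, because Θ is a factor contained in the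
class number formula for the pth cyclotomic field" (p0008:L47–L48) plus elementary algebra
("(1 − 2ψ(2))Θ = pψ(2)B … This shows B ≠ 0", p0009:L53–L54).

This file proves that implication on the typed statements:
`Kubota_rank_abelian_charFormula → Kubota1965_lemma3_Leopoldt →
Kubota1965_theorem2_fermatType_nondegenerate`.  The character formula is discharged by seat
typer-2 (`Kubota_rank_abelian_charFormula_holds`, `KubotaLit2.lean`), so Theorem 2 is now CLOSED
MODULO Lemma 3 alone (whose proof needs `L(0, ψ) ≠ 0` for odd `ψ`, i.e. the value `−B_{1,ψ}` of the
Dirichlet `L`-function at `s = 0` — not in Mathlib as of this check, cf. the TODO in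
`Mathlib/NumberTheory/LSeries/HurwitzZetaValues.lean`).  No new named fact (D-0026).
-/

namespace HodgeRepro.Lit2

open Finset

/-- **Kubota 1965, Theorem 2 follows from Lemma 3 (Leopoldt) and the character formula** — the
printed proof (p.121): every odd character of `(ℤ/p)^×` has non-vanishing half-sum, so the rank is
`1 + #{odd characters} = 1 + (p−1)/2 = d + 1`. -/
theorem Kubota1965_theorem2_of_lemma3 (hchar : Kubota_rank_abelian_charFormula)
    (h3 : Kubota1965_lemma3_Leopoldt) : Kubota1965_theorem2_fermatType_nondegenerate := by
  intro p _ hp hp2 T hH hρ hS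
  have hr := hchar (ZMod p)ˣ T hH
  have hd : T.dim = T.S.card := T.dim_eq_card_S_of_H_eq_bot hH
  have hcardS : 2 * T.S.card = Fintype.card (ZMod p)ˣ := T.two_mul_card_S
  have hodd := two_mul_card_odd_char (G := (ZMod p)ˣ) T.ρ_ne_one T.ρ_mul_self
  -- every odd character has non-vanishing half-sum (Lemma 3), so the second condition is vacuous
  have hequiv : Nat.card {χ : (ZMod p)ˣ →* ℂˣ // χ T.ρ = -1 ∧ (∑ s ∈ T.S, (χ s : ℂ)) ≠ 0} =
      Nat.card {χ : (ZMod p)ˣ →* ℂˣ // χ T.ρ = -1} := by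
    apply Nat.card_congr
    refine
      { toFun := fun χ => ⟨χ.1, χ.2.1⟩
        invFun := fun χ => ⟨χ.1, χ.2, ?_⟩
        left_inv := fun χ => rfl
        right_inv := fun χ => rfl }
    have hne := h3 p hp hp2 χ.1 (by rw [← hρ]; exact χ.2)
    rwa [← hS] at hne
  unfold CMTriple.IsNondegenerate
  rw [hr, hequiv, hd]
  have hG : Nat.card (ZMod p)ˣ = Fintype.card (ZMod p)ˣ := Nat.card_eq_fintype_card
  omega

end HodgeRepro.Lit2
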